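import Summits.BirchSwinnertonDyer.BirchSwinnertonDyer.Theorems.KolyvaginRoadThreeMethod2KolyvaginLocalGross
import Summits.BirchSwinnertonDyer.BirchSwinnertonDyer.Theorems.KolyvaginRoadThreeMethod2LocalDictionaries
import Literature.NumberTheory.EllipticCurves.HeegnerPointsKolyvaginProp82Proofs
import HarnessLib

/-!
# KOLY method line, crux stmt-BirchSwinnertonDyer-19574 `ZhangSharpFrameAtThreeHL`, stub S2-ENGINE: the KUMMER
# EIGEN-LINE AT A KOLYVAGIN PRIME — binder (Line) `hline` of `Method2.triangulation_of_kolyvaginLocal` (p508963)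
# (cell `bsd-stepL`, seat `bsd-stepL-zhang3-p1` g9; `--supports 19574`, helper)

At a Kolyvagin prime `λ = (ℓ)` of the Hoffstein–Luo frame (`Zhang2014.IsKolyvaginPrime (W.conductorNorm ℤ) W K 3 ℓ`,
`ρ̄_{E,3}` onto, `K` imaginary quadratic with non-trivial automorphism `c`), for each sign `s`, the localisations at
`λ` of the `c`-eigenclasses `x ∈ H¹(K, E[3])^{s}` that are SELMER at `λ` (`selmerLocalKer`, i.e. unramified) lie on
ONE integral line of `H¹(K_λ, E[3])`: `∃ e, ∀ x, loc_λ x ∈ ℤ e`. This is W. Zhang 2014, Lemma 8.4 (1) "`dim H¹_f(K_λ,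
E[p])^± = 1`" in the form the engine consumes; the proof is Gross 1991, Prop. 8.1/8.2/9.6 on global objects:

* the bridge Zhang ⟹ Gross at `p = 3` (`KolyLocal.isKolyvaginPrime_three_of_zhang`, p512093) gives Gross's Frobenius
  lift at `λ` (`exists_frobeniusLift_of_isKolyvaginPrime`): a lift `t` of `c` to `K̄`, an arithmetic Frobenius `F` of
  `Γ_K` at the prime `𝔓 ∣ λ` cut out by the chosen embedding `K̄ → K̄_λ`, fixing `E[3]`, with `t⁻¹ F t = F`, `t² = 1` on
  `E[3]` with non-zero eigenvectors of both signs;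
* Gross's Prop. 9.6 (`mem_torsionLocalKer_iff_h1Eval_eq_zero`): for `x` Selmer (= unramified, `λ ∤ 3N` good) at `λ`,
  `loc_λ x = 0 ⟺ [x, F] = 0`, and `x ↦ [x, F] ∈ E[3]` is additive (`h1Eval_add`, `F ∈ Γ_{K(E[3])}`);
* `[x, F]` is a `t`-eigenvector of sign `s` for `x ∈ H¹(K, E[3])^{s}` (`torsionMap_h1Eval_eq_of_conjAct_eq`);
* the `s`-eigenspace of the involution `t` on `E[3] ≅ (ℤ/3)²` with both signs present is a line
  (`mem_zmultiples_of_eigen_of_eigen`, counting: it contains `ℤ Q_s` of order `3` and misses `Q_{-s} ≠ 0`, `3` odd).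
Hence `[x, F] ∈ ℤ [x₀, F]` for any eigen-Selmer `x₀` with `loc_λ x₀ ≠ 0`, i.e. `loc_λ x = a • loc_λ x₀`; if there is
no such `x₀` every `loc_λ x` vanishes and `e = 0` serves.

References: W. Zhang, Camb. J. Math. 2 (2014), Lemma 8.4 (1), §8.1; B. H. Gross, *Kolyvagin's work on modular elliptic
curves* (1991), Prop. 8.1, 8.2, 9.6.
-/

noncomputable section

open scoped Classical

namespace Summit.BirchSwinnertonDyer.Rank1Residual.X11b.Three.Koly.Method2.KolyLocal

open WeierstrassCurve NumberField IsDedekindDomain Field Literature.NumberTheory.EllipticCurves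
  Literature.NumberTheory.GaloisRepresentations

/-! ## §1 Linear algebra: an eigenspace of an involution of `(ℤ/p)²` with both signs present is a line -/

/-- **The `ν`-eigenspace is the line `ℤ xp`.** Let `T` be an abelian group of order `p²` killed by the odd prime `p`,
`ι : T →+ T`, `ν = ±1`, `xp ≠ 0` with `ι xp = ν xp` and `xm ≠ 0` with `ι xm = -ν xm`. Then every `w` with
`ι w = ν w` lies in `ℤ xp`: the eigen-subgroup `N = {ι = ν}` contains `ℤ xp` (order `p`) so has order `p` or `p²`;
order `p²` would put `xm` in `N`, and `ν xm = -ν xm` forces `xm = 0` as `p` is odd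
(`KolyvaginReciprocity.eq_zero_of_eigen_of_mem_zmultiples`); so `N = ℤ xp`. (Gross 1991, proof of Prop. 8.1 (2):
"`E_p^±` are one-dimensional".) [cite: GrossLMS1991, Prop. 8.1 (2) (proof)] -/
theorem mem_zmultiples_of_eigen_of_eigen {T : Type*} [AddCommGroup T] {p : ℕ} (hp : p.Prime) (hp2 : p ≠ 2)
    (hcard : Nat.card T = p ^ 2) (hpT : ∀ t : T, p • t = 0) (ι : T →+ T) {ν : ℤ} (hν : ν = 1 ∨ ν = -1)
    {xp xm : T} (hxp0 : xp ≠ 0) (hxp : ι xp = ν • xp) (hxm0 : xm ≠ 0) (hxm : ι xm = -(ν • xm))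
    {w : T} (hw : ι w = ν • w) : w ∈ AddSubgroup.zmultiples xp := by
  haveI : Fact p.Prime := ⟨hp⟩
  haveI : Finite T := Nat.finite_of_card_ne_zero (by rw [hcard]; exact pow_ne_zero 2 hp.ne_zero)
  -- the eigen-subgroup `N = {t | ι t = ν t}`
  let N : AddSubgroup T :=
    { carrier := {t | ι t = ν • t}
      add_mem' := fun {a b} ha hb ↦ by
        simp only [Set.mem_setOf_eq] at ha hb ⊢
        rw [map_add, ha, hb, smul_add]
      zero_mem' := by simp only [Set.mem_setOf_eq, map_zero, smul_zero]
      neg_mem' := fun {a} ha ↦ by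
        simp only [Set.mem_setOf_eq] at ha ⊢
        rw [map_neg, ha, smul_neg] }
  have hwN : w ∈ N := hw
  have hHle : AddSubgroup.zmultiples xp ≤ N := by
    rw [AddSubgroup.zmultiples_le]
    exact hxp
  by_contra hwn
  have hordx : addOrderOf xp = p := addOrderOf_eq_prime (hpT xp) hxp0
  have hcardH : Nat.card (AddSubgroup.zmultiples xp) = p := by rw [Nat.card_zmultiples, hordx]
  have hdvd : Nat.card N ∣ p ^ 2 := hcard ▸ N.card_addSubgroup_dvd_card
  obtain ⟨i, hi, hNi⟩ := (Nat.dvd_prime_pow hp).mp hdvd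
  have hpdvd : p ∣ Nat.card N := hcardH ▸ AddSubgroup.card_dvd_of_le hHle
  interval_cases i
  · rw [pow_zero] at hNi
    rw [hNi, Nat.dvd_one] at hpdvd
    exact hp.one_lt.ne' hpdvd
  · rw [pow_one] at hNi
    have heq : AddSubgroup.zmultiples xp = N := AddSubgroup.eq_of_le_of_card_ge hHle (by rw [hNi, hcardH])
    exact hwn (heq ▸ hwN)
  · have htop : N = ⊤ := AddSubgroup.eq_top_of_card_eq N (by rw [hNi, hcard])
    have hxmN : xm ∈ N := htop ▸ AddSubgroup.mem_top xm
    exact hxm0 (KolyvaginReciprocity.eq_zero_of_eigen_of_mem_zmultiples hp hp2 hpT ι hν hxm hxmN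
      (AddSubgroup.mem_zmultiples xm))

/-! ## §2 The Kummer eigen-line at a Kolyvagin prime -/

variable (W : WeierstrassCurve ℚ) (K : Type) [Field K] [NumberField K] [W.IsElliptic] [W.IsGloballyMinimal]

/-- **(Line) at a Kolyvagin prime of the HL frame** — binder `hline` of `Method2.triangulation_of_kolyvaginLocal`, per
prime and per place `v ∋ ℓ` (`v = λ`): for each sign `s` there is `e ∈ H¹(K_λ, E[3])` with `loc_λ x ∈ ℤ e` for every
`c`-eigenclass `x ∈ H¹(K, E[3])^{s}` Selmer at `λ`. See the module docstring for the proof (Gross's Frobenius lift,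
Prop. 9.6, eigen-line counting). [cite: WZhang2014, Lemma 8.4 (1), §8.1] [cite: GrossLMS1991, Prop. 8.1, Prop. 9.6] -/
theorem exists_kummerEigenLine (hK : IsImaginaryQuadratic K) (hsurj : W.HasSurjectiveModNGaloisRep 3)
    {c : K ≃ₐ[ℚ] K} (hc : c ≠ 1) {ℓ : ℕ} (hℓ : Zhang2014.IsKolyvaginPrime (W.conductorNorm ℤ) W K 3 ℓ)
    (v : HeightOneSpectrum (𝓞 K)) (hv : (ℓ : 𝓞 K) ∈ v.asIdeal) (s : Bool) :
    ∃ e : galoisCohomology (((W.baseChange K).torsionGaloisModule ((3 ^ 1 : ℕ) : ℤ)).toLocal (Sum.inr v)) 1,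
      ∀ x : V3 W K, conjAct W c ((3 ^ 1 : ℕ) : ℤ) x = sgn s • x →
        x ∈ selmerLocalKer (W.baseChange K) (v.adicCompletion K) ((3 ^ 1 : ℕ) : ℤ) →
        ∃ a : ℤ, galoisCohomology.localization ((W.baseChange K).torsionGaloisModule ((3 ^ 1 : ℕ) : ℤ))
          (Sum.inr v) 1 x = a • e := by
  classical
  -- ### Gross's Kolyvagin prime; `v = λ`; good reduction and `3 ∉ λ`
  have hℓG := isKolyvaginPrime_three_of_zhang W K hK hsurj hℓ
  have hvw : v = hℓG.place := hℓG.mem_iff.mp hv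
  subst hvw
  obtain ⟨hgood, h3v⟩ := hasGoodReductionAt_of_kolyvagin W K hℓ hℓG.place hv
  have hvbad : hℓG.place ∉ (W.baseChange K).badPlaces (𝓞 K) := fun h ↦ h hgood
  haveI : CharZero (hℓG.place.adicCompletion K) :=
    charZero_of_injective_algebraMap (algebraMap K (hℓG.place.adicCompletion K)).injective
  -- ### the prime `𝔓 ∣ λ` of `\bar ℤ_K` cut out by the chosen embedding `K̄ → \bar{K_λ}`
  obtain ⟨𝔐, h𝔐⟩ := hℓG.place.localPrimesAbove_nonempty
  have h𝔓 : hℓG.place.primeBelow (closureEmb (K := K) (hℓG.place.adicCompletion K)) 𝔐 ∈ hℓG.place.primesAbove :=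
    HeightOneSpectrum.primeBelow_mem_primesAbove h𝔐
  -- ### Gross's Frobenius lift at `𝔓`
  obtain ⟨h, c₀, F, ht, -, -, -, -, hF, -, hFT, hcF, -, ⟨Qp, hQp0, hQp⟩, ⟨Qm, hQm0, hQm⟩, -⟩ :=
    exists_frobeniusLift_of_isKolyvaginPrime W hK Nat.prime_three (by norm_num) hc hℓG h𝔓
  have hFT' : F ∈ torsionFixing (W.baseChange K) ((3 ^ 1 : ℕ) : ℤ) := hFT
  have hI : (hℓG.place.primeBelow (closureEmb (K := K) (hℓG.place.adicCompletion K)) 𝔐).inertia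
      (absoluteGaloisGroup K) ≤ torsionFixing (W.baseChange K) ((3 ^ 1 : ℕ) : ℤ) :=
    inertia_le_torsionFixing (W.baseChange K) hvbad h3v _ h𝔐
  have hopen : IsOpen (torsionFixing (W.baseChange K) ((3 ^ 1 : ℕ) : ℤ) : Set (absoluteGaloisGroup K)) :=
    isOpen_torsionFixing (W.baseChange K) (by norm_num)
  have hbij := (torsionPointsMap_bijective (W.baseChange K) (hℓG.place.adicCompletion K) (n := 3 ^ 1)
    (by norm_num)).2
  -- ### Prop. 9.6: for `x` Selmer at `λ`, `loc_λ x = 0 ⟺ [x, F] = 0`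
  have hcrit : ∀ x : V3 W K, x ∈ selmerLocalKer (W.baseChange K) (hℓG.place.adicCompletion K) ((3 ^ 1 : ℕ) : ℤ) →
      (galoisCohomology.localization ((W.baseChange K).torsionGaloisModule ((3 ^ 1 : ℕ) : ℤ)) (Sum.inr hℓG.place) 1
          x = 0 ↔ h1Eval (W.baseChange K) ((3 ^ 1 : ℕ) : ℤ) x F = 0) := by
    intro x hx
    have hxunr : x ∈ unramifiedKer (geomTorsion (W.baseChange K) ((3 ^ 1 : ℕ) : ℤ))
        (hℓG.place.primeBelow (closureEmb (K := K) (hℓG.place.adicCompletion K)) 𝔐) := by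
      rw [← (W.baseChange K).selmerLocalKer_eq_unramifiedKer hgood h3v h𝔓]; exact hx
    rw [← mem_torsionLocalKer_iff_localization_eq_zero W K hℓG.place x]
    exact mem_torsionLocalKer_iff_h1Eval_eq_zero (W.baseChange K) ((3 ^ 1 : ℕ) : ℤ) h𝔐 hF hFT' hI hopen hbij hxunr
  -- ### `[x, F]` is a `t`-eigenvector of sign `s` for `x ∈ H¹(K, E[3])^{s}`
  have hsign : ∀ x : V3 W K, conjAct W c ((3 ^ 1 : ℕ) : ℤ) x = sgn s • x →
      ht.torsionMap W ((3 ^ 1 : ℕ) : ℤ) (h1Eval (W.baseChange K) ((3 ^ 1 : ℕ) : ℤ) x F) =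
        sgn s • h1Eval (W.baseChange K) ((3 ^ 1 : ℕ) : ℤ) x F :=
    fun x hx ↦ torsionMap_h1Eval_eq_of_conjAct_eq W ht ((3 ^ 1 : ℕ) : ℤ) hFT' hcF hx
  -- ### `E[3] ≅ (ℤ/3)²`, killed by `3`; eigenvectors of signs `s` and `-s`
  have hν : sgn s = 1 ∨ sgn s = -1 := by cases s <;> simp [sgn]
  have hTp : ∀ P : geomTorsion (W.baseChange K) ((3 ^ 1 : ℕ) : ℤ), 3 • P = 0 := fun P ↦ by
    have := (mem_geomTorsion_iff (W.baseChange K) ((3 ^ 1 : ℕ) : ℤ) _).mp P.2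
    apply Subtype.ext
    rw [AddSubgroupClass.coe_nsmul, ← natCast_zsmul]
    exact this
  have hcard : Nat.card (geomTorsion (W.baseChange K) ((3 ^ 1 : ℕ) : ℤ)) = 3 ^ 2 :=
    card_torsionPoints_eq_sq_holds (W.baseChange K) (AlgebraicClosure K) (n := 3) (by norm_num)
  obtain ⟨Q₁, Q₂, hQ₁0, hQ₁, hQ₂0, hQ₂⟩ : ∃ Q₁ Q₂ : geomTorsion (W.baseChange K) ((3 ^ 1 : ℕ) : ℤ), Q₁ ≠ 0 ∧
      ht.torsionMap W ((3 ^ 1 : ℕ) : ℤ) Q₁ = sgn s • Q₁ ∧ Q₂ ≠ 0 ∧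
        ht.torsionMap W ((3 ^ 1 : ℕ) : ℤ) Q₂ = -(sgn s • Q₂) := by
    cases s
    · refine ⟨Qm, Qp, hQm0, ?_, hQp0, ?_⟩
      · show ht.torsionMap W ((3 : ℕ) : ℤ) Qm = _
        rw [hQm, show sgn false = -1 from rfl, neg_one_zsmul]
      · show ht.torsionMap W ((3 : ℕ) : ℤ) Qp = _
        rw [hQp, show sgn false = -1 from rfl, neg_one_zsmul, neg_neg]
    · refine ⟨Qp, Qm, hQp0, ?_, hQm0, ?_⟩
      · show ht.torsionMap W ((3 : ℕ) : ℤ) Qp = _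
        rw [hQp, show sgn true = 1 from rfl, one_zsmul]
      · show ht.torsionMap W ((3 : ℕ) : ℤ) Qm = _
        rw [hQm, show sgn true = 1 from rfl, one_zsmul]
  -- ### the line
  by_cases hex : ∃ x₀ : V3 W K, conjAct W c ((3 ^ 1 : ℕ) : ℤ) x₀ = sgn s • x₀ ∧
      x₀ ∈ selmerLocalKer (W.baseChange K) (hℓG.place.adicCompletion K) ((3 ^ 1 : ℕ) : ℤ) ∧
      h1Eval (W.baseChange K) ((3 ^ 1 : ℕ) : ℤ) x₀ F ≠ 0
  · obtain ⟨x₀, hx₀s, hx₀K, hx₀0⟩ := hex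
    refine ⟨galoisCohomology.localization ((W.baseChange K).torsionGaloisModule ((3 ^ 1 : ℕ) : ℤ))
      (Sum.inr hℓG.place) 1 x₀, fun x hxs hxK ↦ ?_⟩
    -- `[x, F] ∈ ℤ [x₀, F]` (the `s`-eigen-line is `ℤ [x₀, F]`)
    have hmem : h1Eval (W.baseChange K) ((3 ^ 1 : ℕ) : ℤ) x F ∈
        AddSubgroup.zmultiples (h1Eval (W.baseChange K) ((3 ^ 1 : ℕ) : ℤ) x₀ F) :=
      mem_zmultiples_of_eigen_of_eigen Nat.prime_three (by norm_num) hcard hTp (ht.torsionMap W ((3 ^ 1 : ℕ) : ℤ))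
        hν hx₀0 (hsign x₀ hx₀s) hQ₂0 hQ₂ (hsign x hxs)
    obtain ⟨a, ha⟩ := AddSubgroup.mem_zmultiples_iff.mp hmem
    refine ⟨a, ?_⟩
    -- `x - a x₀` is Selmer at `λ` with `[x - a x₀, F] = 0`, so `loc_λ (x - a x₀) = 0`
    have hdiff : x - a • x₀ ∈ selmerLocalKer (W.baseChange K) (hℓG.place.adicCompletion K) ((3 ^ 1 : ℕ) : ℤ) :=
      sub_mem hxK (AddSubgroup.zsmul_mem _ hx₀K a)
    have hval0 : h1Eval (W.baseChange K) ((3 ^ 1 : ℕ) : ℤ) (x - a • x₀) F = 0 := by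
      rw [sub_eq_add_neg, h1Eval_add (W.baseChange K) ((3 ^ 1 : ℕ) : ℤ) _ _ hFT',
        h1Eval_neg (W.baseChange K) ((3 ^ 1 : ℕ) : ℤ) _ hFT', h1Eval_zsmul (W.baseChange K) ((3 ^ 1 : ℕ) : ℤ) _ _ hFT',
        ha, add_neg_cancel]
    have hloc0 := (hcrit (x - a • x₀) hdiff).mpr hval0
    -- (additivity of `loc_λ`, stated with the map explicit: the two models of `H¹(K, E[3])` agree definitionally)
    have hsub := map_sub (galoisCohomology.localization ((W.baseChange K).torsionGaloisModule ((3 ^ 1 : ℕ) : ℤ))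
      (Sum.inr hℓG.place) 1) x (a • x₀)
    have hsm := map_zsmul (galoisCohomology.localization ((W.baseChange K).torsionGaloisModule ((3 ^ 1 : ℕ) : ℤ))
      (Sum.inr hℓG.place) 1) a x₀
    exact (sub_eq_zero.mp (hsub.symm.trans hloc0)).trans hsm
  · -- no eigen-Selmer class with `[x₀, F] ≠ 0`: all their localisations vanish
    push Not at hex
    refine ⟨0, fun x hxs hxK ↦ ⟨0, ?_⟩⟩
    rw [zero_smul]
    exact (hcrit x hxK).mpr (hex x hxs hxK)

end Summit.BirchSwinnertonDyer.Rank1Residual.X11b.Three.Koly.Method2.KolyLocal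

end
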